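import Literature.Probability.FitznerVanDerHofstad2017.NobleJointTwoLevelIota
import Literature.Probability.FitznerVanDerHofstad2017.NobleRerouteJointWit
import HarnessLib

/-!
# Fitzner–van der Hofstad (2017), §6.1: re-routing the level-`0` witnesses of the `ι`-event onto an open class-`1` bond

[FvdH17] = R. Fitzner, R. van der Hofstad, *Mean-field behavior for nearest-neighbor percolation in `d > 10`*,
Electron. J. Probab. **22** (2017), no. 43, arXiv:1506.07977v2; §6.1 proof of Lemma 5.3, "Case `a = 1`"
(p. 59: "we conclude from `a = 1` that `u` and `w` are neighbors … the connection `{w ↔ u}` is the bond"), and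
(4.66)–(4.67) for the two line families `F^{ι,I}_0`, `F^{ι,II}_0` (p. 44).

The level-`0` lines of the `ι`-event (`NobleJointTwoLevelIota.jwιLinesI/II`) are, for part `I`,
`{0↔e}, {e↔w}, {w↔u}, {w↔z}, {e↔u}` — a triangle `e, w, u` with the two pendants `0–e` and `w–z` — and, for
part `II` with `u = e`, `{0↔w}, {w↔e}, {e↔e}, {e↔e}, {w↔z}` — a path `0, w, e` with the pendant `w–z`.  In class
`a = 1` the bond `(u,w)` is open; it lies in at most one of the pairwise bond-disjoint witnesses, and the
deterministic re-pairing below produces witnesses of the SAME lines in which `{w↔u}` (resp. `{w↔e}`) is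
witnessed by the bond alone and every other witness avoids it (the pendant `{0↔e}` through the bond is cut at
the bond and re-closed through the third side of the triangle; the triangle itself is
`NobleRerouteClassOneBond.exists_reroute_openConn`).  Output form: the predicate `JointWitnessedι` over the
PINNED line families `jwιLinesIpin` / `jwιLinesIIpin`, so that the grouped-BK lemmas of
`NobleJointTwoLevelIotaKit` apply unchanged to the class-`(1,b)` cells.

Deterministic graph theory only: no measure, no letter, no dimension.
-/

namespace Literature.Probability.FitznerVanDerHofstad2017

open Literature.Barriers.CriticalPhenomena Literature.Probability.Percolation
open Literature.Probability.LatticeModels Literature.Combinatorics.SimpleGraph _root_.SimpleGraph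

/-! ### A. Generic re-routing lemmas (any vertex type) -/

section Generic

variable {V : Type*}

/-- Concatenating witnesses: `A ∈ {a↔b}`, `B ∈ {b↔c}` give `A ∪ B ∈ {a↔c}` (file-private plumbing). [folklore] -/
private theorem union_mem_openConn {A B : Set (Sym2 V)} {a b c : V}
    (hA : A ∈ (openConn a b : Set (BondConfig V))) (hB : B ∈ (openConn b c : Set (BondConfig V))) :
    A ∪ B ∈ (openConn a c : Set (BondConfig V)) :=
  show (openGraph (A ∪ B)).Reachable a c from
    (SimpleGraph.Reachable.mono (openGraph_mono Set.subset_union_left) hA).trans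
      (SimpleGraph.Reachable.mono (openGraph_mono Set.subset_union_right) hB)

/-- `{a↔b} = {b↔a}` at witness level (file-private plumbing). [folklore] -/
private theorem symm_mem_openConn {A : Set (Sym2 V)} {a b : V} (hA : A ∈ (openConn a b : Set (BondConfig V))) :
    A ∈ (openConn b a : Set (BondConfig V)) :=
  show (openGraph A).Reachable b a from SimpleGraph.Reachable.symm hA

/-- **Splitting a witness at a bond.** If `K ∈ {a ↔ c}` contains the bond `s(w,u)` on one of its simple open
paths, that path splits at the bond into two bond-disjoint pieces avoiding it, ending at the two endpoints of the
bond in one of the two orders. If no simple path of `K` from `a` to `c` uses the bond, `K` contains a witness of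
`{a ↔ c}` avoiding it. [cite: FitznerVanDerHofstad2017, §6.1 proof of Lemma 5.3, Case a = 1 (arXiv:1506.07977v2 p. 59)] -/
theorem exists_split_openConn_at {a c w u : V} {K : Set (Sym2 V)} (hK : K ∈ (openConn a c : Set (BondConfig V))) :
    (∃ A ⊆ K, A ∈ (openConn a c : Set (BondConfig V)) ∧ s(w, u) ∉ A) ∨
    (∃ A B : Set (Sym2 V), A ⊆ K ∧ B ⊆ K ∧ s(w, u) ∉ A ∧ s(w, u) ∉ B ∧ Disjoint A B ∧
      ((A ∈ (openConn a w : Set (BondConfig V)) ∧ B ∈ (openConn u c : Set (BondConfig V))) ∨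
       (A ∈ (openConn a u : Set (BondConfig V)) ∧ B ∈ (openConn w c : Set (BondConfig V))))) := by
  classical
  obtain ⟨W⟩ := hK
  set P := W.bypass with hPdef
  have hPK : ∀ x ∈ P.edges, x ∈ K := fun x hx => mem_of_mem_walk_edges W (W.edges_bypass_subset_edges hx)
  by_cases hb : s(w, u) ∈ P.edges
  swap
  · exact Or.inl ⟨{x | x ∈ P.edges}, fun x hx => hPK x hx, edgesSet_mem_openConn P, hb⟩
  right
  obtain ⟨a', b', q₁, hadj, q₂, hPq, hab, hq₁⟩ := LaceGraph.exists_first_edge_eq P hb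
  have hnd : P.edges.Nodup := (W.bypass_isPath).isTrail.edges_nodup
  rw [hPq, Walk.edges_append, Walk.edges_cons] at hnd
  have hq₂ : s(a', b') ∉ q₂.edges := (List.nodup_cons.1 hnd.of_append_right).1
  rw [hab] at hq₂
  have hdq : List.Disjoint q₁.edges (s(a', b') :: q₂.edges) := List.disjoint_of_nodup_append hnd
  have hq₁K : {x | x ∈ q₁.edges} ⊆ K := fun x hx =>
    hPK x (by rw [hPq, Walk.edges_append]; exact List.mem_append_left _ hx)
  have hq₂K : {x | x ∈ q₂.edges} ⊆ K := fun x hx =>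
    hPK x (by rw [hPq, Walk.edges_append, Walk.edges_cons]; exact List.mem_append_right _ (List.mem_cons_of_mem _ hx))
  have hd₁₂ : Disjoint ({x | x ∈ q₁.edges} : Set (Sym2 V)) {x | x ∈ q₂.edges} :=
    Set.disjoint_left.2 fun x hx hx' => hdq hx (List.mem_cons_of_mem _ hx')
  refine ⟨{x | x ∈ q₁.edges}, {x | x ∈ q₂.edges}, hq₁K, hq₂K, hq₁, hq₂, hd₁₂, ?_⟩
  rcases Sym2.eq_iff.1 hab with ⟨rfl, rfl⟩ | ⟨rfl, rfl⟩
  · exact Or.inl ⟨edgesSet_mem_openConn q₁, edgesSet_mem_openConn q₂⟩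
  · exact Or.inr ⟨edgesSet_mem_openConn q₁, edgesSet_mem_openConn q₂⟩

/-- **Re-routing the part-`I` pattern onto the bond `(w,u)`** (triangle `e, w, u` with pendants `o–e`, `w–z`).
Given pairwise bond-disjoint witnesses `K₀ ∈ {o↔e}`, `K₁ ∈ {e↔w}`, `K₂ ∈ {w↔u}`, `K₃ ∈ {w↔z}`, `K₄ ∈ {e↔u}`,
there are pairwise bond-disjoint witnesses `A ∈ {o↔e}`, `B ∈ {e↔w}`, `C ∈ {w↔z}`, `D ∈ {e↔u}` AVOIDING the
bond `s(w,u)`, with `A, B, D ⊆ K₀ ∪ K₁ ∪ K₂ ∪ K₄` and `C ⊆ K₂ ∪ K₃` — so that `A, B, {s(w,u)}, C, D` witness the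
five lines again as soon as `w ∼ u`.  (If the pendant witness `K₀` passes through the bond, cut it there and close
`{o↔e}` through `K₄` or `K₁`, re-witnessing the freed side through the far piece of `K₀` and `K₂`; otherwise
`exists_reroute_openConn` on the triangle.)
[cite: FitznerVanDerHofstad2017, §6.1 proof of Lemma 5.3, Case a = 1; (4.66) (arXiv:1506.07977v2 pp. 44, 59)] -/
theorem exists_rerouteιI_openConn {o e u w z : V} {K₀ K₁ K₂ K₃ K₄ : Set (Sym2 V)}
    (hK₀ : K₀ ∈ (openConn o e : Set (BondConfig V))) (hK₁ : K₁ ∈ (openConn e w : Set (BondConfig V)))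
    (hK₂ : K₂ ∈ (openConn w u : Set (BondConfig V))) (hK₃ : K₃ ∈ (openConn w z : Set (BondConfig V)))
    (hK₄ : K₄ ∈ (openConn e u : Set (BondConfig V)))
    (d₀₁ : Disjoint K₀ K₁) (d₀₂ : Disjoint K₀ K₂) (d₀₃ : Disjoint K₀ K₃) (d₀₄ : Disjoint K₀ K₄)
    (d₁₂ : Disjoint K₁ K₂) (d₁₃ : Disjoint K₁ K₃) (d₁₄ : Disjoint K₁ K₄) (d₂₃ : Disjoint K₂ K₃)
    (d₂₄ : Disjoint K₂ K₄) (d₃₄ : Disjoint K₃ K₄) :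
    ∃ A B C D : Set (Sym2 V),
      A ⊆ K₀ ∪ K₁ ∪ K₂ ∪ K₄ ∧ B ⊆ K₀ ∪ K₁ ∪ K₂ ∪ K₄ ∧ C ⊆ K₂ ∪ K₃ ∧ D ⊆ K₀ ∪ K₁ ∪ K₂ ∪ K₄ ∧
      A ∈ (openConn o e : Set (BondConfig V)) ∧ B ∈ (openConn e w : Set (BondConfig V)) ∧
      C ∈ (openConn w z : Set (BondConfig V)) ∧ D ∈ (openConn e u : Set (BondConfig V)) ∧
      s(w, u) ∉ A ∧ s(w, u) ∉ B ∧ s(w, u) ∉ C ∧ s(w, u) ∉ D ∧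
      Disjoint A B ∧ Disjoint A C ∧ Disjoint A D ∧ Disjoint B C ∧ Disjoint B D ∧ Disjoint C D := by
  classical
  have m₀ : K₀ ⊆ K₀ ∪ K₁ ∪ K₂ ∪ K₄ := fun x hx => Or.inl (Or.inl (Or.inl hx))
  have m₁ : K₁ ⊆ K₀ ∪ K₁ ∪ K₂ ∪ K₄ := fun x hx => Or.inl (Or.inl (Or.inr hx))
  have m₂ : K₂ ⊆ K₀ ∪ K₁ ∪ K₂ ∪ K₄ := fun x hx => Or.inl (Or.inr hx)
  have m₄ : K₄ ⊆ K₀ ∪ K₁ ∪ K₂ ∪ K₄ := fun x hx => Or.inr hx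
  have m₃ : K₃ ⊆ K₂ ∪ K₃ := fun x hx => Or.inr hx
  by_cases h₀ : s(w, u) ∈ K₀
  · -- the bond lies on the pendant witness `K₀`, hence off `K₁, …, K₄`
    have n₁ : s(w, u) ∉ K₁ := fun h => Set.disjoint_left.1 d₀₁ h₀ h
    have n₂ : s(w, u) ∉ K₂ := fun h => Set.disjoint_left.1 d₀₂ h₀ h
    have n₃ : s(w, u) ∉ K₃ := fun h => Set.disjoint_left.1 d₀₃ h₀ h
    have n₄ : s(w, u) ∉ K₄ := fun h => Set.disjoint_left.1 d₀₄ h₀ h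
    rcases exists_split_openConn_at (w := w) (u := u) hK₀ with ⟨A, hAK, hA, nA⟩ | ⟨X, Y, hX, hY, nX, nY, dXY, hXY⟩
    · exact ⟨A, K₁, K₃, K₄, hAK.trans m₀, m₁, m₃, m₄, hA, hK₁, hK₃, hK₄, nA, n₁, n₃, n₄,
        d₀₁.mono_left hAK, d₀₃.mono_left hAK, d₀₄.mono_left hAK, d₁₃, d₁₄, d₃₄⟩
    rcases hXY with ⟨hXw, hYu⟩ | ⟨hXu, hYw⟩
    · -- `o … w → u … e`: `{o↔e} := X ∪ K₁⁻¹`, `{e↔w} := Y⁻¹ ∪ K₂⁻¹`, `{e↔u} := K₄`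
      refine ⟨X ∪ K₁, Y ∪ K₂, K₃, K₄, Set.union_subset (hX.trans m₀) m₁, Set.union_subset (hY.trans m₀) m₂, m₃,
        m₄, union_mem_openConn hXw (symm_mem_openConn hK₁),
        union_mem_openConn (symm_mem_openConn hYu) (symm_mem_openConn hK₂), hK₃, hK₄,
        fun h => h.elim nX n₁, fun h => h.elim nY n₂, n₃, n₄, ?_, ?_, ?_, ?_, ?_, d₃₄⟩
      · exact Disjoint.union_left (Disjoint.union_right dXY (d₀₂.mono_left hX))
          (Disjoint.union_right (d₀₁.symm.mono_right hY) d₁₂)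
      · exact Disjoint.union_left (d₀₃.mono_left hX) d₁₃
      · exact Disjoint.union_left (d₀₄.mono_left hX) d₁₄
      · exact Disjoint.union_left (d₀₃.mono_left hY) d₂₃
      · exact Disjoint.union_left (d₀₄.mono_left hY) d₂₄
    · -- `o … u → w … e`: `{o↔e} := X ∪ K₄⁻¹`, `{e↔u} := Y⁻¹ ∪ K₂`, `{e↔w} := K₁`
      refine ⟨X ∪ K₄, K₁, K₃, Y ∪ K₂, Set.union_subset (hX.trans m₀) m₄, m₁, m₃, Set.union_subset (hY.trans m₀) m₂,
        union_mem_openConn hXu (symm_mem_openConn hK₄), hK₁, hK₃,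
        union_mem_openConn (symm_mem_openConn hYw) hK₂,
        fun h => h.elim nX n₄, n₁, n₃, fun h => h.elim nY n₂, ?_, ?_, ?_, d₁₃, ?_, ?_⟩
      · exact Disjoint.union_left (d₀₁.mono_left hX) d₁₄.symm
      · exact Disjoint.union_left (d₀₃.mono_left hX) d₃₄.symm
      · exact Disjoint.union_left (Disjoint.union_right dXY (d₀₂.mono_left hX))
          (Disjoint.union_right (d₀₄.symm.mono_right hY) d₂₄.symm)
      · exact Disjoint.union_right (d₀₁.symm.mono_right hY) d₁₂
      · exact Disjoint.union_right (d₀₃.symm.mono_right hY) d₂₃.symm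
  · -- the bond is off the pendant: re-route the triangle
    obtain ⟨D, B, C, hDsub, hBsub, hCsub, -, hD, hB, hC, nD, nB, nC, dDB, dDC, dBC⟩ :=
      exists_reroute_openConn (o := e) (u := u) (w := w) (z := z) hK₄ hK₁ hK₂ hK₃ d₁₄.symm d₂₄.symm d₃₄.symm
        d₁₂ d₁₃ d₂₃
    have hP : K₄ ∪ K₁ ∪ K₂ ⊆ K₀ ∪ K₁ ∪ K₂ ∪ K₄ := fun x hx =>
      hx.elim (fun h => h.elim (fun h => m₄ h) (fun h => m₁ h)) (fun h => m₂ h)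
    have d₀P : Disjoint K₀ (K₄ ∪ K₁ ∪ K₂) := Disjoint.union_right (Disjoint.union_right d₀₄ d₀₁) d₀₂
    refine ⟨K₀, B, C, D, m₀, hBsub.trans hP, fun x hx => (hCsub hx).elim Or.inr Or.inl, hDsub.trans hP, hK₀, hB,
      hC, hD, h₀, nB, nC, nD, d₀P.mono_right hBsub, ?_, d₀P.mono_right hDsub, dBC, dDB.symm, dDC.symm⟩
    exact Disjoint.mono_right hCsub (Disjoint.union_right d₀₃ d₀₂)

/-- **Re-routing the part-`II` pattern onto the bond `(e,w)`** (path `o, w, e` with pendant `w–z`). Given pairwise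
bond-disjoint witnesses `K₀ ∈ {o↔w}`, `K₁ ∈ {w↔e}`, `K₄ ∈ {w↔z}`, there are bond-disjoint witnesses `A ∈ {o↔w}`,
`C ∈ {w↔z}` AVOIDING `s(e,w)`, with `A ⊆ K₀ ∪ K₁`, `C ⊆ K₁ ∪ K₄` (cut the witness through the bond at the bond and
re-close through `K₁`). [cite: FitznerVanDerHofstad2017, §6.1 proof of Lemma 5.3, Case a = 1; (4.67) (arXiv:1506.07977v2 pp. 44, 59)] -/
theorem exists_rerouteιII_openConn {o e w z : V} {K₀ K₁ K₄ : Set (Sym2 V)}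
    (hK₀ : K₀ ∈ (openConn o w : Set (BondConfig V))) (hK₁ : K₁ ∈ (openConn w e : Set (BondConfig V)))
    (hK₄ : K₄ ∈ (openConn w z : Set (BondConfig V)))
    (d₀₁ : Disjoint K₀ K₁) (d₀₄ : Disjoint K₀ K₄) (d₁₄ : Disjoint K₁ K₄) :
    ∃ A C : Set (Sym2 V), A ⊆ K₀ ∪ K₁ ∧ C ⊆ K₁ ∪ K₄ ∧
      A ∈ (openConn o w : Set (BondConfig V)) ∧ C ∈ (openConn w z : Set (BondConfig V)) ∧
      s(e, w) ∉ A ∧ s(e, w) ∉ C ∧ Disjoint A C := by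
  classical
  by_cases h₀ : s(e, w) ∈ K₀
  · have n₁ : s(e, w) ∉ K₁ := fun h => Set.disjoint_left.1 d₀₁ h₀ h
    have n₄ : s(e, w) ∉ K₄ := fun h => Set.disjoint_left.1 d₀₄ h₀ h
    rcases exists_split_openConn_at (w := e) (u := w) hK₀ with ⟨A, hAK, hA, nA⟩ | ⟨X, Y, hX, hY, nX, nY, -, hXY⟩
    · exact ⟨A, K₄, hAK.trans Set.subset_union_left, Set.subset_union_right, hA, hK₄, nA, n₄, d₀₄.mono_left hAK⟩
    rcases hXY with ⟨hXe, -⟩ | ⟨hXw, -⟩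
    · -- `o … e → w`: `{o↔w} := X ∪ K₁⁻¹`
      exact ⟨X ∪ K₁, K₄, Set.union_subset (hX.trans Set.subset_union_left) Set.subset_union_right,
        Set.subset_union_right, union_mem_openConn hXe (symm_mem_openConn hK₁), hK₄, fun h => h.elim nX n₁, n₄,
        Disjoint.union_left (d₀₄.mono_left hX) d₁₄⟩
    · exact ⟨X, K₄, hX.trans Set.subset_union_left, Set.subset_union_right, hXw, hK₄, nX, n₄, d₀₄.mono_left hX⟩
  by_cases h₄ : s(e, w) ∈ K₄
  · have n₁ : s(e, w) ∉ K₁ := fun h => Set.disjoint_left.1 d₁₄ h h₄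
    rcases exists_split_openConn_at (w := e) (u := w) hK₄ with ⟨C, hCK, hC, nC⟩ | ⟨X, Y, hX, hY, nX, nY, -, hXY⟩
    · exact ⟨K₀, C, Set.subset_union_left, hCK.trans Set.subset_union_right, hK₀, hC, h₀, nC, d₀₄.mono_right hCK⟩
    rcases hXY with ⟨-, hYw⟩ | ⟨-, hYe⟩
    · exact ⟨K₀, Y, Set.subset_union_left, hY.trans Set.subset_union_right, hK₀, hYw, h₀, nY, d₀₄.mono_right hY⟩
    · -- `w → e … z`: `{w↔z} := K₁ ∪ Y`
      exact ⟨K₀, K₁ ∪ Y, Set.subset_union_left, Set.union_subset Set.subset_union_left (hY.trans Set.subset_union_right),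
        hK₀, union_mem_openConn hK₁ hYe, h₀, fun h => h.elim n₁ nY, Disjoint.union_right d₀₁ (d₀₄.mono_right hY)⟩
  · exact ⟨K₀, K₄, Set.subset_union_left, Set.subset_union_right, hK₀, hK₄, h₀, h₄, d₀₄⟩

end Generic

/-! ### B. The pinned line families and the re-routed `ι`-predicate -/

variable {d : ℕ}

/-- `∀ i : Fin 5` as a conjunction (file-private plumbing). [folklore] -/
private theorem forall_fin_five {P : Fin 5 → Prop} : (∀ i, P i) ↔ P 0 ∧ P 1 ∧ P 2 ∧ P 3 ∧ P 4 :=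
  ⟨fun h => ⟨h 0, h 1, h 2, h 3, h 4⟩, fun h i => by
    obtain ⟨h0, h1, h2, h3, h4⟩ := h
    fin_cases i
    exacts [h0, h1, h2, h3, h4]⟩

/-- Pairwise disjointness of five sets from the ten pairs (file-private plumbing). [folklore] -/
private theorem pairwise_disjoint_vec5 {α : Type*} {a b c e f : Set α}
    (h01 : Disjoint a b) (h02 : Disjoint a c) (h03 : Disjoint a e) (h04 : Disjoint a f) (h12 : Disjoint b c)
    (h13 : Disjoint b e) (h14 : Disjoint b f) (h23 : Disjoint c e) (h24 : Disjoint c f) (h34 : Disjoint e f) :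
    Pairwise fun i j => Disjoint (![a, b, c, e, f] i) (![a, b, c, e, f] j) := by
  intro i j hij
  fin_cases i <;> fin_cases j <;> simp at hij ⊢ <;>
    first | assumption | exact Disjoint.symm ‹_›

/-- The part-`I` lines PINNED at the class-`1` bond `(u,w)`: `{w↔u}` is witnessed by the bond alone, the other
four lines by witnesses avoiding it. [cite: FitznerVanDerHofstad2017, §6.1 proof of Lemma 5.3, Case a = 1; (4.66) (arXiv:1506.07977v2 pp. 44, 59)] -/
def jwιLinesIpin (e u w z : Site d) : Fin 5 → Set (BondConfig (Site d)) :=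
  ![openConn 0 e ∩ {K | s(u, w) ∉ K}, openConn e w ∩ {K | s(u, w) ∉ K}, {K | K = {s(u, w)}},
    openConn w z ∩ {K | s(u, w) ∉ K}, openConn e u ∩ {K | s(u, w) ∉ K}]

/-- The part-`II` lines (`u = e`) PINNED at the class-`1` bond `(e,w)`: `{w↔e}` is the bond, the two trivial lines
`{e↔e}` are witnessed by `∅`, and `{0↔w}`, `{w↔z}` avoid the bond.
[cite: FitznerVanDerHofstad2017, §6.1 proof of Lemma 5.3, Case a = 1; (4.67) (arXiv:1506.07977v2 pp. 44, 59)] -/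
def jwιLinesIIpin (e w z : Site d) : Fin 5 → Set (BondConfig (Site d)) :=
  ![openConn 0 w ∩ {K | s(e, w) ∉ K}, {K | K = {s(e, w)}}, {K | K = ∅}, {K | K = ∅},
    openConn w z ∩ {K | s(e, w) ∉ K}]

/-- **Part `I`, class `a = 1`: the `ι`-predicate re-routed onto the open bond `(u,w)`.** If the bond `(u,w)`
(`u ≠ w`) is open in `α`, off `β`, differs from the excluded bond `b` and from `(t,z)`, then the witnesses of the
part-`I` lines may be re-chosen PINNED at the bond, all side clauses preserved.
[cite: FitznerVanDerHofstad2017, §6.1 proof of Lemma 5.3, Case a = 1; (4.66) (arXiv:1506.07977v2 pp. 44, 59)] -/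
theorem JointWitnessedι.pinI {e u w z v t x : Site d} {b : Sym2 (Site d)} {α β : BondConfig (Site d)}
    (h : JointWitnessedι (jwιLinesI e u w z) {3} b z v t x α β) (hα : s(u, w) ∈ α)
    (hβ : s(u, w) ∉ β) (hb : b ≠ s(u, w)) (htz : z ≠ t → s(t, z) ≠ s(u, w)) :
    JointWitnessedι (jwιLinesIpin e u w z) {3} b z v t x α β := by
  obtain ⟨K₀, K₁, h₀, h₁, hL₀, hL₁, hd₀, hd₁, hc₀, hc₁, hbd, hI⟩ := h
  have n : ∀ {i j : Fin 5}, i ≠ j → Disjoint (K₀ i) (K₀ j) := fun hij => hd₀ hij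
  have l0 : K₀ 0 ∈ (openConn (0 : Site d) e : Set (BondConfig (Site d))) := hL₀ 0
  have l1 : K₀ 1 ∈ (openConn e w : Set (BondConfig (Site d))) := hL₀ 1
  have l2 : K₀ 2 ∈ (openConn w u : Set (BondConfig (Site d))) := hL₀ 2
  have l3 : K₀ 3 ∈ (openConn w z : Set (BondConfig (Site d))) := hL₀ 3
  have l4 : K₀ 4 ∈ (openConn e u : Set (BondConfig (Site d))) := hL₀ 4
  obtain ⟨A, B, C, D, hA, hB, hC, hD, mA, mB, mC, mD, nA, nB, nC, nD, dAB, dAC, dAD, dBC, dBD, dCD⟩ :=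
    exists_rerouteιI_openConn l0 l1 l2 l3 l4 (n (by decide)) (n (by decide))
      (n (by decide)) (n (by decide)) (n (by decide)) (n (by decide)) (n (by decide)) (n (by decide))
      (n (by decide)) (n (by decide))
  have hsw : s(w, u) = s(u, w) := Sym2.eq_swap
  rw [hsw] at nA nB nC nD
  -- the two pools and their properties
  have hUα : K₀ 0 ∪ K₀ 1 ∪ K₀ 2 ∪ K₀ 4 ⊆ α :=
    Set.union_subset (Set.union_subset (Set.union_subset (h₀ 0) (h₀ 1)) (h₀ 2)) (h₀ 4)
  have hU'α : K₀ 2 ∪ K₀ 3 ⊆ α := Set.union_subset (h₀ 2) (h₀ 3)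
  have hUb : b ∉ K₀ 0 ∪ K₀ 1 ∪ K₀ 2 ∪ K₀ 4 := fun hm =>
    hm.elim (fun hm => hm.elim (fun hm => hm.elim (hI 0 (by decide)) (hI 1 (by decide))) (hI 2 (by decide)))
      (hI 4 (by decide))
  have hUc₀ : Disjoint (K₁ 0) (K₀ 0 ∪ K₀ 1 ∪ K₀ 2 ∪ K₀ 4) :=
    Disjoint.union_right (Disjoint.union_right (Disjoint.union_right (hc₀ 0) (hc₀ 1)) (hc₀ 2)) (hc₀ 4)
  have hUc₁ : Disjoint (K₁ 1) (K₀ 0 ∪ K₀ 1 ∪ K₀ 2 ∪ K₀ 4) :=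
    Disjoint.union_right (Disjoint.union_right (Disjoint.union_right (hc₁ 0) (hc₁ 1)) (hc₁ 2)) (hc₁ 4)
  have hU'c₀ : Disjoint (K₁ 0) (K₀ 2 ∪ K₀ 3) := Disjoint.union_right (hc₀ 2) (hc₀ 3)
  have hU'c₁ : Disjoint (K₁ 1) (K₀ 2 ∪ K₀ 3) := Disjoint.union_right (hc₁ 2) (hc₁ 3)
  have hUtz : z ≠ t → s(t, z) ∉ K₀ 0 ∪ K₀ 1 ∪ K₀ 2 ∪ K₀ 4 := fun hzt hm =>
    hm.elim (fun hm => hm.elim (fun hm => hm.elim (hbd hzt 0) (hbd hzt 1)) (hbd hzt 2)) (hbd hzt 4)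
  have hU'tz : z ≠ t → s(t, z) ∉ K₀ 2 ∪ K₀ 3 := fun hzt hm => hm.elim (hbd hzt 2) (hbd hzt 3)
  have hsβ₀ : s(u, w) ∉ K₁ 0 := fun hm => hβ (h₁ 0 hm)
  have hsβ₁ : s(u, w) ∉ K₁ 1 := fun hm => hβ (h₁ 1 hm)
  refine ⟨![A, B, {s(u, w)}, C, D], K₁, ?_, h₁, ?_, hL₁, ?_, hd₁, ?_, ?_, ?_, ?_⟩
  · exact forall_fin_five.2 ⟨hA.trans hUα, hB.trans hUα, Set.singleton_subset_iff.2 hα, hC.trans hU'α,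
      hD.trans hUα⟩
  · exact forall_fin_five.2 ⟨⟨mA, nA⟩, ⟨mB, nB⟩, rfl, ⟨mC, nC⟩, ⟨mD, nD⟩⟩
  · exact pairwise_disjoint_vec5 dAB (Set.disjoint_singleton_right.2 nA) dAC dAD
      (Set.disjoint_singleton_right.2 nB) dBC dBD (Set.disjoint_singleton_left.2 nC)
      (Set.disjoint_singleton_left.2 nD) dCD
  · exact forall_fin_five.2 ⟨hUc₀.mono_right hA, hUc₀.mono_right hB, Set.disjoint_singleton_right.2 hsβ₀,
      hU'c₀.mono_right hC, hUc₀.mono_right hD⟩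
  · exact forall_fin_five.2 ⟨hUc₁.mono_right hA, hUc₁.mono_right hB, Set.disjoint_singleton_right.2 hsβ₁,
      hU'c₁.mono_right hC, hUc₁.mono_right hD⟩
  · intro hzt
    exact forall_fin_five.2 ⟨fun hm => hUtz hzt (hA hm), fun hm => hUtz hzt (hB hm),
      fun hm => htz hzt (Set.mem_singleton_iff.1 hm), fun hm => hU'tz hzt (hC hm), fun hm => hUtz hzt (hD hm)⟩
  · intro i hi
    fin_cases i
    · exact fun hm => hUb (hA hm)
    · exact fun hm => hUb (hB hm)
    · exact fun hm => hb (Set.mem_singleton_iff.1 hm)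
    · exact absurd (Finset.mem_singleton_self _) hi
    · exact fun hm => hUb (hD hm)

/-- **Part `II` (`u = e`), class `a = 1`: the `ι`-predicate re-routed onto the open bond `(e,w)`.** If the bond
`(e,w)` (`w ≠ e`) is open in `α`, off `β`, differs from `b` and from `(t,z)`, then the witnesses of the part-`II`
lines may be re-chosen PINNED at the bond (the two trivial lines `{e↔e}` witnessed by `∅`), all side clauses
preserved. [cite: FitznerVanDerHofstad2017, §6.1 proof of Lemma 5.3, Case a = 1; (4.67) (arXiv:1506.07977v2 pp. 44, 59)] -/
theorem JointWitnessedι.pinII {e w z v t x : Site d} {b : Sym2 (Site d)} {α β : BondConfig (Site d)}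
    (h : JointWitnessedι (jwιLinesII e e w z) ∅ b z v t x α β) (hα : s(e, w) ∈ α)
    (hβ : s(e, w) ∉ β) (hb : b ≠ s(e, w)) (htz : z ≠ t → s(t, z) ≠ s(e, w)) :
    JointWitnessedι (jwιLinesIIpin e w z) ∅ b z v t x α β := by
  obtain ⟨K₀, K₁, h₀, h₁, hL₀, hL₁, hd₀, hd₁, hc₀, hc₁, hbd, hI⟩ := h
  have n : ∀ {i j : Fin 5}, i ≠ j → Disjoint (K₀ i) (K₀ j) := fun hij => hd₀ hij
  have l0 : K₀ 0 ∈ (openConn (0 : Site d) w : Set (BondConfig (Site d))) := hL₀ 0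
  have l1 : K₀ 1 ∈ (openConn w e : Set (BondConfig (Site d))) := hL₀ 1
  have l4 : K₀ 4 ∈ (openConn w z : Set (BondConfig (Site d))) := hL₀ 4
  obtain ⟨A, C, hA, hC, mA, mC, nA, nC, dAC⟩ :=
    exists_rerouteιII_openConn l0 l1 l4 (n (by decide)) (n (by decide)) (n (by decide))
  have hUα : K₀ 0 ∪ K₀ 1 ⊆ α := Set.union_subset (h₀ 0) (h₀ 1)
  have hU'α : K₀ 1 ∪ K₀ 4 ⊆ α := Set.union_subset (h₀ 1) (h₀ 4)
  have hUb : b ∉ K₀ 0 ∪ K₀ 1 := fun hm =>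
    hm.elim (hI 0 (Finset.notMem_empty _)) (hI 1 (Finset.notMem_empty _))
  have hU'b : b ∉ K₀ 1 ∪ K₀ 4 := fun hm =>
    hm.elim (hI 1 (Finset.notMem_empty _)) (hI 4 (Finset.notMem_empty _))
  have hUc₀ : Disjoint (K₁ 0) (K₀ 0 ∪ K₀ 1) := Disjoint.union_right (hc₀ 0) (hc₀ 1)
  have hUc₁ : Disjoint (K₁ 1) (K₀ 0 ∪ K₀ 1) := Disjoint.union_right (hc₁ 0) (hc₁ 1)
  have hU'c₀ : Disjoint (K₁ 0) (K₀ 1 ∪ K₀ 4) := Disjoint.union_right (hc₀ 1) (hc₀ 4)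
  have hU'c₁ : Disjoint (K₁ 1) (K₀ 1 ∪ K₀ 4) := Disjoint.union_right (hc₁ 1) (hc₁ 4)
  have hUtz : z ≠ t → s(t, z) ∉ K₀ 0 ∪ K₀ 1 := fun hzt hm => hm.elim (hbd hzt 0) (hbd hzt 1)
  have hU'tz : z ≠ t → s(t, z) ∉ K₀ 1 ∪ K₀ 4 := fun hzt hm => hm.elim (hbd hzt 1) (hbd hzt 4)
  have hsβ₀ : s(e, w) ∉ K₁ 0 := fun hm => hβ (h₁ 0 hm)
  have hsβ₁ : s(e, w) ∉ K₁ 1 := fun hm => hβ (h₁ 1 hm)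
  refine ⟨![A, {s(e, w)}, ∅, ∅, C], K₁, ?_, h₁, ?_, hL₁, ?_, hd₁, ?_, ?_, ?_, ?_⟩
  · exact forall_fin_five.2 ⟨hA.trans hUα, Set.singleton_subset_iff.2 hα, Set.empty_subset _, Set.empty_subset _,
      hC.trans hU'α⟩
  · exact forall_fin_five.2 ⟨⟨mA, nA⟩, rfl, rfl, rfl, ⟨mC, nC⟩⟩
  · exact pairwise_disjoint_vec5 (Set.disjoint_singleton_right.2 nA) (Set.disjoint_empty _) (Set.disjoint_empty _)
      dAC (Set.disjoint_empty _) (Set.disjoint_empty _) (Set.disjoint_singleton_left.2 nC)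
      (Set.disjoint_empty _) (Set.disjoint_empty _).symm (Set.disjoint_empty _).symm
  · exact forall_fin_five.2 ⟨hUc₀.mono_right hA, Set.disjoint_singleton_right.2 hsβ₀, Set.disjoint_empty _,
      Set.disjoint_empty _, hU'c₀.mono_right hC⟩
  · exact forall_fin_five.2 ⟨hUc₁.mono_right hA, Set.disjoint_singleton_right.2 hsβ₁, Set.disjoint_empty _,
      Set.disjoint_empty _, hU'c₁.mono_right hC⟩
  · intro hzt
    exact forall_fin_five.2 ⟨fun hm => hUtz hzt (hA hm), fun hm => htz hzt (Set.mem_singleton_iff.1 hm),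
      Set.notMem_empty _, Set.notMem_empty _, fun hm => hU'tz hzt (hC hm)⟩
  · intro i _
    fin_cases i
    · exact fun hm => hUb (hA hm)
    · exact fun hm => hb (Set.mem_singleton_iff.1 hm)
    · exact Set.notMem_empty _
    · exact Set.notMem_empty _
    · exact fun hm => hU'b (hC hm)

/-! ### C. Inside the `ι`-event: class `a = 1` pins the level-`0` witnesses -/

open Literature.Probability.FitznerVanDerHofstad2017.NobleBlocks in
/-- **Part `I`, `u ≠ e_ι`, class `a = 1`**: on `jointWitIotaI` with the bond `(u,w)` open at level `0`,
the `ι`-predicate holds over the pinned part-`I` lines. [cite: FitznerVanDerHofstad2017, §6.1 proof of Lemma 5.3, Case a = 1; (4.66) (arXiv:1506.07977v2 pp. 44, 59)] -/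
theorem jointWitnessedι_pinI_of_mem {ι : Fin d × Bool} {x u v w z t : Site d} {ω : Fin 2 → BondConfig (Site d)}
    (hu : u ≠ stepVec ι) (hω : ω ∈ jointWitIotaI ι x u v w z t) (hcl : s(u, w) ∈ ω 0) :
    JointWitnessedι (jwιLinesIpin (stepVec ι) u w z) {3} s((0 : Site d), stepVec ι) z v t x
      (offBonds {s(u, v)} (ω 0)) (offBonds (bondsAt {u}) (ω 1)) := by
  have hs : JWιSide u v w z t x := hω.1
  refine hω.2.2.pinI (mem_offBonds_singleton_of_ne hs.2.2.1 hcl) (not_mem_offBonds_bondsAt_self u w _)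
    (fun he => ?_) (fun _ => sym2_ne_of_ne hs.2.2.2.2.1 hs.2.2.2.2.2.1)
  rcases Sym2.eq_iff.1 he with ⟨h0, hew⟩ | ⟨h0, heu⟩
  · exact hs.1 h0.symm
  · exact hu heu.symm

open Literature.Probability.FitznerVanDerHofstad2017.NobleBlocks in
/-- **Part `II`, `u = e_ι`, class `a = 1`**: on `jointWitIotaII` (with `u = e_ι`) with the bond `(e_ι,w)` open at
level `0`, the `ι`-predicate holds over the pinned part-`II` lines (`w ≠ 0` by the clause `C2` of the event).
[cite: FitznerVanDerHofstad2017, §6.1 proof of Lemma 5.3, Case a = 1; (4.67) (arXiv:1506.07977v2 pp. 44, 59)] -/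
theorem jointWitnessedι_pinII_of_mem {ι : Fin d × Bool} {x v w z t : Site d} {ω : Fin 2 → BondConfig (Site d)}
    (hω : ω ∈ jointWitIotaII ι x (stepVec ι) v w z t) (hcl : s(stepVec ι, w) ∈ ω 0) :
    JointWitnessedι (jwιLinesIIpin (stepVec ι) w z) ∅ s((0 : Site d), stepVec ι) z v t x
      (offBonds {s(stepVec ι, v)} (ω 0)) (offBonds (bondsAt {stepVec ι}) (ω 1)) := by
  have hs : JWιSide (stepVec ι) v w z t x := hω.1
  refine hω.2.2.2.2.2.pinII (mem_offBonds_singleton_of_ne hs.2.2.1 hcl) (not_mem_offBonds_bondsAt_self _ w _)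
    (fun he => ?_) (fun _ => sym2_ne_of_ne hs.2.2.2.2.1 hs.2.2.2.2.2.1)
  rcases Sym2.eq_iff.1 he with ⟨h0, -⟩ | ⟨h0, -⟩
  · exact (((zdGraph_adj_iff_stepVec (0 : Site d) _).2 ⟨ι, by simp⟩).ne) h0
  · -- `w = 0`: the bond is `b_ι`, excluded by the clause `C2`
    have hw0 : w = 0 := h0.symm
    subst hw0
    exact hω.2.2.2.2.1 rfl rfl (by rw [Sym2.eq_swap]; exact hcl)

end Literature.Probability.FitznerVanDerHofstad2017
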